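import Summits.KontsevichZagierPeriods.KontsevichZagierPeriods.Theorems.SoloBlindAngleBox
import HarnessLib

/-!
# The tangent cell in the period ring: `x_π⁴ = 96·[T, w]`

Two more dissections by coordinate hyperplanes (rule (1)) and the transfer move (rule (2)) of
`SoloBlindZigzag` compute the class of the tangent cell `T` of `SoloBlindTanHalf` with the
angle weight `w = ∏ᵢ 2/(1+tᵢ²)` in the period ring `Q`:

* `[T, w] = [T₊, w] + [T₊ ∘ (0 2), w] = 2·[T₊, w]` (`T` and `w` are invariant under `t₀ ↔ t₂`),
* `[T₊, w] ≡ [O, w]` (the zigzag transfer chart, `SoloBlindAngleBox.zigPiece_equiv_tanHalfPiece`),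
* `[O, w] = [Δ_{(1 3 2 0)}, w] + [Δ_{(3 1 2 0)}, w] = 2·[Δ, w]` (split `O` by `s₁ ≶ s₃`),

and with `[(0,1)⁴, w] = 24·[Δ, w] = (2·a(1))⁴` (`SoloBlindAngleBox`):
**`6·[T, w] = (2·a(1))⁴` and `x_π⁴ = 96·[T, w]` in `Q`** (`xPi_pow_four`).  In angles this is
`vol {uᵢ > 0, uᵢ + uᵢ₊₁ < π/2} = (π/2)⁴/6`, i.e. Stanley's count `2/4!` of the linear extensions
of the zigzag poset times the symmetry factor `2` — performed inside the Kontsevich–Zagier rules.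
-/

noncomputable section

namespace Summit.KontsevichZagierPeriods.KontsevichZagierPeriods.Theorems

open Set MeasureTheory
open Literature.ModelTheory.ExponentialFields (IsSemialgebraic)
open Literature.NumberTheory.Transcendental
open Literature.NumberTheory.Transcendental.KZ

namespace SoloBlind

/-! ## Dissection of `T` by `t₀ ≶ t₂` -/

/-- The coordinate swap `t₀ ↔ t₂`. -/
def swap02 : Equiv.Perm (Fin 4) := Equiv.swap 0 2

/-- `T` is invariant under `t₀ ↔ t₂` (the cyclic conditions are the same four pairs). -/
theorem swap_mem_tanCell {t : Fin 4 → ℝ} (ht : t ∈ tanCell) :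
    (fun i => t (swap02 i)) ∈ tanCell := by
  have h0 := ht 0; have h1 := ht 1; have h2 := ht 2; have h3 := ht 3
  simp only [Fin.isValue, Fin.reduceAdd] at h0 h1 h2 h3
  have e0 : swap02 0 = 2 := by decide
  have e1 : swap02 1 = 1 := by decide
  have e2 : swap02 2 = 0 := by decide
  have e3 : swap02 3 = 3 := by decide
  intro i
  fin_cases i <;>
    simp only [Fin.zero_eta, Fin.isValue, Fin.mk_one, Fin.reduceFinMk, Fin.reduceAdd, e0, e1, e2,
      e3] <;> constructor <;> nlinarith

/-- The mirror half `T₊ ∘ (0 2) = T ∩ {t₂ < t₀}` as a representation: `[T₊, w]` re-indexed. -/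
def tanHalfPiece' : IntegralRep 4 := tanHalfPiece.reindex swap02

/-- Membership in the mirror half. -/
theorem mem_tanHalfPiece'_domain {t : Fin 4 → ℝ} :
    t ∈ tanHalfPiece'.domain ↔ (fun i => t (swap02 i)) ∈ tanHalfCell := Iff.rfl

/-- Undoing the swap. -/
theorem swap_swap_apply (t : Fin 4 → ℝ) : (fun i => (fun j => t (swap02 j)) (swap02 i)) = t := by
  funext i; simp [swap02, Equiv.swap_apply_self]

/-- **Dissection (rule (1))**: `[T, w] − [T₊, w] − [T₊ ∘ (0 2), w] ∈ relations`. -/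
theorem tanPiece_sub : of tanPiece - of tanHalfPiece - of tanHalfPiece' ∈ relations := by
  have e0 : swap02 0 = 2 := by decide
  have e2 : swap02 2 = 0 := by decide
  have key := of_sub_sum_of_mem_relations (Finset.univ : Finset (Fin 2)) tanPiece
    ![tanHalfPiece, tanHalfPiece'] ?_ ?_ ?_ ?_
  · simpa [Fin.sum_univ_two, sub_sub] using key
  · intro k _
    refine measure_mono_null (fun t ht => (ht.2 ?_).elim) measure_empty
    have ht1 := ht.1
    fin_cases k
    · exact tanHalfCell_subset ht1
    · have h := swap_mem_tanCell (mem_tanHalfPiece'_domain.mp ht1).1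
      rwa [swap_swap_apply] at h
  · intro k _ t _
    fin_cases k
    · simp [tanPiece, tanHalfPiece]
    · show tanHalfPiece.integrand (fun i => t (swap02 i)) = tanPiece.integrand t
      simp only [tanHalfPiece, tanPiece, anglePiece_integrand]
      exact tanWeight_perm swap02 t
  · refine measure_mono_null ?_ (Literature.Analysis.SpecialFunctions.Selberg.volume_setOf_apply_eq
      (show (0 : Fin 4) ≠ 2 by decide))
    rintro t ⟨ht, hnot⟩
    have ht : t ∈ tanCell := ht
    simp only [Finset.mem_univ, iUnion_true, mem_iUnion, not_exists] at hnot
    by_contra h02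
    rcases lt_or_gt_of_ne h02 with h | h
    · exact hnot 0 (show t ∈ tanHalfCell from ⟨ht, h⟩)
    · refine hnot 1 (mem_tanHalfPiece'_domain.mpr ⟨swap_mem_tanCell ht, ?_⟩)
      show t (swap02 0) < t (swap02 2)
      rwa [e0, e2]
  · intro i _ j _ hij
    show volume ((![tanHalfPiece, tanHalfPiece'] i).domain ∩
      (![tanHalfPiece, tanHalfPiece'] j).domain) = 0
    rw [show ((![tanHalfPiece, tanHalfPiece'] i).domain ∩
        (![tanHalfPiece, tanHalfPiece'] j).domain) = ∅ from ?_, measure_empty]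
    refine eq_empty_of_forall_notMem fun t ⟨hi, hj⟩ => ?_
    have aux : ∀ {u : Fin 4 → ℝ}, u ∈ tanHalfPiece.domain → u ∈ tanHalfPiece'.domain → False := by
      intro u hu hu'
      have h1 : u 0 < u 2 := hu.2
      have h2 : u (swap02 0) < u (swap02 2) := (mem_tanHalfPiece'_domain.mp hu').2
      rw [e0, e2] at h2
      exact lt_asymm h1 h2
    fin_cases i <;> fin_cases j
    · exact hij rfl
    · exact aux hi hj
    · exact aux hj hi
    · exact hij rfl

/-- **`[T, w] = 2·[T₊, w]` in `Q`.** -/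
theorem mkQ_tanPiece_eq : mkQ (of tanPiece) = 2 • mkQ (of tanHalfPiece) := by
  have h1 : mkQ (of tanPiece - of tanHalfPiece) = mkQ (of tanHalfPiece') :=
    mkQ_eq_mkQ_iff.mpr tanPiece_sub
  have h2 : mkQ (of tanHalfPiece) = mkQ (of tanHalfPiece') :=
    mkQ_eq_mkQ_iff.mpr (of_sub_of_reindex_mem_relations _ _)
  rw [map_sub, sub_eq_iff_eq_add] at h1
  rw [h1, ← h2, two_nsmul]

/-! ## Dissection of `O` by `s₁ ≶ s₃` -/

/-- Membership of an explicit `4`-vector in `Δ₄`. -/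
theorem vec_mem_openOrderedSimplex {a b c d : ℝ} :
    ![a, b, c, d] ∈ openOrderedSimplex 4 ↔ 0 < d ∧ d < c ∧ c < b ∧ b < a ∧ a < 1 := by
  simp only [openOrderedSimplex, mem_setOf_eq, Fin.strictAnti_iff_succ_lt, Fin.forall_fin_succ,
    IsEmpty.forall_iff, and_true, Fin.succ_zero_eq_one, Fin.succ_one_eq_two, Fin.castSucc_zero,
    Fin.castSucc_one, Matrix.cons_val_zero, Matrix.cons_val_one, Matrix.cons_val_succ,
    Matrix.cons_val]
  constructor
  · rintro ⟨⟨-, -, -, hd⟩, ⟨ha, -, -, -⟩, hba, hcb, hdc⟩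
    exact ⟨hd, hdc, hcb, hba, ha⟩
  · rintro ⟨hd, hdc, hcb, hba, ha⟩
    exact ⟨⟨by linarith, by linarith, by linarith, hd⟩, ⟨ha, by linarith, by linarith, by linarith⟩,
      hba, hcb, hdc⟩

/-- The two orders of `O`, as the sequences of coordinates in decreasing order. -/
def zigOrderFun : Fin 2 → Fin 4 → Fin 4 := ![![1, 3, 2, 0], ![3, 1, 2, 0]]

/-- Each is a permutation. -/
theorem zigOrderFun_injective (k : Fin 2) : Function.Injective (zigOrderFun k) := by
  fin_cases k <;> decide

/-- The two order permutations of `O`. -/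
def zigOrderPerm (k : Fin 2) : Equiv.Perm (Fin 4) :=
  Equiv.ofBijective (zigOrderFun k) (Finite.injective_iff_bijective.mp (zigOrderFun_injective k))

/-- Values of the order permutations. -/
@[simp] theorem zigOrderPerm_apply (k : Fin 2) (i : Fin 4) : zigOrderPerm k i = zigOrderFun k i :=
  rfl

/-- Membership in the first order cell of `O`: `s₀ < s₂ < s₃ < s₁`. -/
theorem mem_orderCell_zig_zero {s : Fin 4 → ℝ} : s ∈ (orderCell (zigOrderPerm 0)).domain ↔
    0 < s 0 ∧ s 0 < s 2 ∧ s 2 < s 3 ∧ s 3 < s 1 ∧ s 1 < 1 := by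
  rw [mem_orderCell_domain, show (fun i => s (zigOrderPerm 0 i)) = ![s 1, s 3, s 2, s 0] from
    funext fun i => by fin_cases i <;> rfl, vec_mem_openOrderedSimplex]

/-- Membership in the second order cell of `O`: `s₀ < s₂ < s₁ < s₃`. -/
theorem mem_orderCell_zig_one {s : Fin 4 → ℝ} : s ∈ (orderCell (zigOrderPerm 1)).domain ↔
    0 < s 0 ∧ s 0 < s 2 ∧ s 2 < s 1 ∧ s 1 < s 3 ∧ s 3 < 1 := by
  rw [mem_orderCell_domain, show (fun i => s (zigOrderPerm 1 i)) = ![s 3, s 1, s 2, s 0] from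
    funext fun i => by fin_cases i <;> rfl, vec_mem_openOrderedSimplex]

/-- **Dissection (rule (1))**: `[O, w] − Σₖ [Δ_{σₖ}, w] ∈ relations`. -/
theorem zigPiece_sub_sum :
    of zigPiece - ∑ k ∈ (Finset.univ : Finset (Fin 2)), of (orderCell (zigOrderPerm k)) ∈
      relations := by
  refine of_sub_sum_of_mem_relations Finset.univ zigPiece (fun k => orderCell (zigOrderPerm k))
    ?_ (fun k _ s _ => by rw [orderCell_integrand]; simp [zigPiece]) ?_ ?_
  · intro k _
    refine measure_mono_null (fun s hs => (hs.2 ?_).elim) measure_empty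
    have hs1 := hs.1
    show s ∈ zigCell
    fin_cases k
    · obtain ⟨h0, h02, h23, h31, h1⟩ := mem_orderCell_zig_zero.mp hs1
      exact ⟨h0, h02, by linarith, h1, h23, by linarith⟩
    · obtain ⟨h0, h02, h21, h13, h3⟩ := mem_orderCell_zig_one.mp hs1
      exact ⟨h0, h02, h21, by linarith, by linarith, h3⟩
  · refine measure_mono_null ?_ (Literature.Analysis.SpecialFunctions.Selberg.volume_setOf_apply_eq
      (show (1 : Fin 4) ≠ 3 by decide))
    rintro s ⟨hs, hnot⟩
    obtain ⟨h0, h02, h21, h1, h23, h3⟩ : s ∈ zigCell := hs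
    simp only [Finset.mem_univ, iUnion_true, mem_iUnion, not_exists] at hnot
    by_contra h13
    rcases lt_or_gt_of_ne h13 with h | h
    · exact hnot 1 (mem_orderCell_zig_one.mpr ⟨h0, h02, h21, h, h3⟩)
    · exact hnot 0 (mem_orderCell_zig_zero.mpr ⟨h0, h02, h23, h, h1⟩)
  · intro i _ j _ hij
    have hne : zigOrderPerm i ≠ zigOrderPerm j := by
      intro h
      have h' := congrArg (fun e : Equiv.Perm (Fin 4) => e 0) h
      fin_cases i <;> fin_cases j <;> simp_all (config := { decide := true })
    show volume ((orderCell (zigOrderPerm i)).domain ∩ (orderCell (zigOrderPerm j)).domain) = 0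
    rw [orderCell_domain_disjoint hne, measure_empty]

/-- **`[O, w] = 2·[Δ, w]` in `Q`.** -/
theorem mkQ_zigPiece_eq : mkQ (of zigPiece) = 2 • mkQ (of simplexPiece) := by
  have h1 := mkQ_eq_mkQ_iff.mpr zigPiece_sub_sum
  have h2 : ∑ k ∈ (Finset.univ : Finset (Fin 2)), of simplexPiece -
      ∑ k ∈ (Finset.univ : Finset (Fin 2)), of (orderCell (zigOrderPerm k)) ∈ relations :=
    sum_sub_sum_mem_relations _ _ _ fun k _ => simplexPiece_sub_orderCell _
  rw [h1, ← mkQ_eq_mkQ_iff.mpr h2, Finset.sum_const, Finset.card_univ, Fintype.card_fin, map_nsmul]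

/-! ## Summary -/

/-- `[T₊, w] = [O, w]` in `Q` (the transfer move). -/
theorem mkQ_tanHalfPiece_eq : mkQ (of tanHalfPiece) = mkQ (of zigPiece) :=
  (mkQ_eq_mkQ_iff.mpr zigPiece_equiv_tanHalfPiece).symm

/-- `[T, w] = 4·[Δ, w]` in `Q`. -/
theorem mkQ_tanPiece_eq_simplex : mkQ (of tanPiece) = 4 • mkQ (of simplexPiece) := by
  rw [mkQ_tanPiece_eq, mkQ_tanHalfPiece_eq, mkQ_zigPiece_eq, ← mul_nsmul]

/-- **`6·[T, w] = (2·a(1))⁴` in `Q`.** -/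
theorem nsmul_mkQ_tanPiece : 6 • mkQ (of tanPiece) = ((2 : K₀) • alpha 1) ^ 4 := by
  rw [mkQ_tanPiece_eq_simplex, ← mul_nsmul, ← mkQ_angleBox, mkQ_angleBox_eq]

/-- **`x_π⁴ = 96·[T, w]` in `Q`.** -/
theorem xPi_pow_four : xPi ^ 4 = 96 • mkQ (of tanPiece) := by
  have h : xPi = (2 : K₀) • ((2 : K₀) • alpha 1) := by
    rw [xPi, smul_smul]; norm_num
  rw [h, smul_pow, ← nsmul_mkQ_tanPiece, smul_comm, show ((2 : K₀)) ^ 4 = ((16 : ℕ) : K₀) by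
    norm_num, Nat.cast_smul_eq_nsmul, ← mul_nsmul]

end SoloBlind

end Summit.KontsevichZagierPeriods.KontsevichZagierPeriods.Theorems
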